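import Literature.IUT.HodgeTheaters.TemperedCoveringsProp24iiObservationGenuine
import Literature.AnabelianGeometry.SemiGraphs.TemperedQuotientByClosedNormal
import HarnessLib

/-!
# [IUTchI] Prop. 2.4 (ii) at the genuine 𝔛-datum: the pull-back compactness (A0) at every level quotient from
# the residual-finiteness reading (RF), via "quotients of tempered groups are tempered"

Mochizuki, *Inter-universal Teichmüller theory I*, kurims manuscript (May 2020), §2, proof of Prop. 2.4 (ii),
p. 50 l. 52 – p. 51 l. 13: p. 50 l. 52–53 "it follows from a similar argument to the argument applied to prove
Proposition 2.1" and p. 51 l. 8–13 "by applying [the evident analogue of] this observation to the quotients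
`Π^tp_X ↠ Π^tp_X/Ker(J ↠ Π^tp_{𝔾*_J})`" (two separate literal clauses; the profinite side `Π̂_X/Ker(Ĵ ↠ Π̂_{𝔾_J})` of the
level quotients used below is the one printed for assertion (i), p. 50 l. 46–49 — cf.-style summary, not a quotation)
[cite: Mochizuki2012, Prop 2.4(ii) pp.50-51] (D-0012 claim key; nothing of the series is asserted here), over
Mochizuki, *Semi-graphs of anabelioids*, Publ. RIMS **42** (2006), Def. 3.1 (i) p. 33 ("tempered") and Ex. 3.10 p. 45
l. 1–4 ("each of the 'outer semi-direct product groups' … is tempered") [cite: MochizukiSemiAnbd2006, Ex 3.10 p.45].  Pages: [IUTchI] = kurims preprint render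
IUTchI-kurims-url-690e7b3c6199; [SemiAnbd] = kurims render SemiAnbd-kurims-url-f33ace170ff4 (lit/SOURCES.md §0/§11).

PROOF-ONLY sequel (abc-iut-L5-t11; no definitions, no new `Prop` fact) of `TemperedCoveringsProp24iiObservationGenuine.lean`.
There the per-level law `hA0` ("the `ι_j`-preimage in `Π^tp_j = Π^temp_{X_K} ⧸ admKer_j` of a `Π̂_j`-conjugate of the image
of a compact open-image `Λ`, lying in `ι(Π^tp_j)`, is compact") was a raw binder.  It is the assertion-(ii) twin of the
step (A0) of this lineage's Prop. 2.1 kernels ("`Λ`, `γΛγ⁻¹` are compact subgroups of `Π^tp`", p. 45), which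
`IsTempered.isCompact_comap` (abc-iut-L5-t11, `TemperedCompactPreimage.lean`) derives from temperedness + the
residual-finiteness reading (RF): "the open normal subgroups of `Π^tp` that are closed for the topology induced from
`Π̂` are cofinal among the neighbourhoods of `1`".  HERE the level quotient `Π^tp_j` IS tempered — by
`IsTempered.quotient_of_isClosed` (`TemperedQuotientByClosedNormal.lean`: a tempered group with first-countable
topology modulo a closed normal subgroup is tempered; `Π^temp_{X_K}` is tempered and second countable by the
parameter bundle `d`, `admKer_j` is closed) — so `hA0` follows from the per-level reading
(RF)_j `hRF : ∀ j, ∀ U ∈ 𝓝 1, ∃ N ⊴ Π^tp_j open normal, N ⊆ U ∧ ι_j⁻¹(closure ι_j(N)) ⊆ N`.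
Result `prop24ii_ofPiData_of_arithStatementI_canonical_of_RF`: [IUTchI] Prop. 2.4 (ii) AS TYPED at the genuine
datum over `P` from `hadm` and, per level, L3's `ArithMaximalCompactStatementI` for the canonical augmentation
(`hI`), (RF)_j (`hRF`), (A3-arith)_j (`hA3`), plus the per-level decomposition/node data.
CONDITIONAL, as labelled; typed ≠ discharged; `P` is origin data inhabited at model towers only; nothing here asserts
that abc is proved or refuted, and nothing here bears on [IUTchIII] Cor. 3.12.
-/

noncomputable section

namespace Literature.IUT.HodgeTheaters

open _root_.Topology
open scoped Pointwise
open Literature.AnabelianGeometry.SemiGraphs Literature.AnabelianGeometry.SemiGraphs.ProfiniteSemiGraph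

namespace StableCurveTemperedData

namespace OfSpecialFibre

variable {p : ℕ} [Fact p.Prime] (X : TemperedCurve p) (T : SpecialFibreTower X.DeltaTemp) (d : X.GroupLevelData)
  (S : SpecialFibreData (X.toTemperedArithmeticGroup d)) (h36 : S.Gc.Prop36Hypotheses)
  (Sigma SigmaHat : Set ℕ) (hsub : Sigma ⊆ SigmaHat) (hne : Set.Nonempty Sigma)
  (hprime : ∀ q ∈ SigmaHat, q.Prime) (hp : p ∉ Sigma) (TpH : Subgroup S.chart.G)
  (HatH : Subgroup (TemperedGraphGroupData.exists_completion_of_prop36 S.Gc h36 S.chart).choose)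
  (hle : TpH.map (TemperedGraphGroupData.exists_completion_of_prop36 S.Gc h36
    S.chart).choose_spec.choose.toMonoidHom ≤ HatH)
  (cuspMeetsH : {x : X.Pt // X.IsCusp x} → Prop)

/-- **The tempered level quotient `Π^tp_j = Π^temp_{X_K} ⧸ admKer_j` is tempered** ("each of the 'outer semi-direct
product groups' … is tempered", [SemiAnbd] Ex. 3.10 p. 45, for the Π-level quotient): `IsTempered.quotient_of_isClosed`
with `Π^temp_{X_K}` tempered and second countable (`d`) and `admKer_j` closed (`isClosed_admKerPi`), normal by (P0).
[cite: MochizukiSemiAnbd2006, Ex 3.10 p.45] -/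
theorem isTempered_levelQuotient_Tp (P : SpecialFibreTower.PiData X d S T) (j : ℕ) :
    IsTempered ((qTowerOfSpecialFibreTower X T d S h36 Sigma SigmaHat hsub hne hprime hp TpH HatH hle cuspMeetsH
      P.admKer_normal_pi).Q j).Tp := by
  haveI : (admKerPi X T j).Normal := P.admKer_normal_pi j
  haveI : SecondCountableTopology X.PiTemp := d.secondCountableTopology
  change IsTempered (X.PiTemp ⧸ admKerPi X T j)
  exact IsTempered.quotient_of_isClosed (admKerPi X T j) d.isTempered (isClosed_admKerPi X T d j)

/-- **(A0) at the level quotient from (RF)**: if the open normal subgroups of `Π^tp_j` closed for the `Π̂_j`-topology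
are cofinal among the neighbourhoods of `1`, then the `ι_j`-preimage of every compact subgroup of `Π̂_j` lying in
`ι_j(Π^tp_j)` is compact (`IsTempered.isCompact_comap` for the tempered `Π^tp_j`; `Π̂_j = Π_{X_K} ⧸ closure ι(admKer_j)`
is Hausdorff). ([IUTchI] Prop 2.4(ii) p.51) [claim: Mochizuki2012, status: disputed] -/
theorem isCompact_comap_levelQuotient_of_RF (P : SpecialFibreTower.PiData X d S T) (j : ℕ)
    (hRF : ∀ U ∈ 𝓝 (1 : ((qTowerOfSpecialFibreTower X T d S h36 Sigma SigmaHat hsub hne hprime hp TpH HatH hle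
        cuspMeetsH P.admKer_normal_pi).Q j).Tp),
      ∃ N : OpenNormalSubgroup ((qTowerOfSpecialFibreTower X T d S h36 Sigma SigmaHat hsub hne hprime hp TpH HatH hle
          cuspMeetsH P.admKer_normal_pi).Q j).Tp,
        (N : Set _) ⊆ U ∧
          ((N.toSubgroup.map ((qTowerOfSpecialFibreTower X T d S h36 Sigma SigmaHat hsub hne hprime hp TpH HatH hle
              cuspMeetsH P.admKer_normal_pi).Q j).ι).topologicalClosure).comap
            ((qTowerOfSpecialFibreTower X T d S h36 Sigma SigmaHat hsub hne hprime hp TpH HatH hle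
              cuspMeetsH P.admKer_normal_pi).Q j).ι ≤ N.toSubgroup)
    (K : Subgroup ((qTowerOfSpecialFibreTower X T d S h36 Sigma SigmaHat hsub hne hprime hp TpH HatH hle
      cuspMeetsH P.admKer_normal_pi).Q j).Hat)
    (hK : IsCompact (K : Set ((qTowerOfSpecialFibreTower X T d S h36 Sigma SigmaHat hsub hne hprime hp TpH HatH hle
      cuspMeetsH P.admKer_normal_pi).Q j).Hat))
    (hKr : K ≤ ((qTowerOfSpecialFibreTower X T d S h36 Sigma SigmaHat hsub hne hprime hp TpH HatH hle
      cuspMeetsH P.admKer_normal_pi).Q j).ι.range) :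
    IsCompact ((K.comap ((qTowerOfSpecialFibreTower X T d S h36 Sigma SigmaHat hsub hne hprime hp TpH HatH hle
      cuspMeetsH P.admKer_normal_pi).Q j).ι : Subgroup ((qTowerOfSpecialFibreTower X T d S h36 Sigma SigmaHat hsub
        hne hprime hp TpH HatH hle cuspMeetsH P.admKer_normal_pi).Q j).Tp) : Set ((qTowerOfSpecialFibreTower X T d S
          h36 Sigma SigmaHat hsub hne hprime hp TpH HatH hle cuspMeetsH P.admKer_normal_pi).Q j).Tp) := by
  haveI : (admKerHat X T j).Normal := admKerHat_normal X T j (P.admKer_normal_pi j)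
  haveI : IsClosed ((admKerHat X T j : Subgroup X.PiHat) : Set X.PiHat) := Subgroup.isClosed_topologicalClosure _
  haveI : T2Space X.PiHat := X.isProfiniteCompletion_toHat.t2Space
  haveI : T2Space ((qTowerOfSpecialFibreTower X T d S h36 Sigma SigmaHat hsub hne hprime hp TpH HatH hle
      cuspMeetsH P.admKer_normal_pi).Q j).Hat := by
    change T2Space (X.PiHat ⧸ admKerHat X T j)
    infer_instance
  exact (isTempered_levelQuotient_Tp X T d S h36 Sigma SigmaHat hsub hne hprime hp TpH HatH hle cuspMeetsH P j).isCompact_comap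
    _ ((qTowerOfSpecialFibreTower X T d S h36 Sigma SigmaHat hsub hne hprime hp TpH HatH hle
      cuspMeetsH P.admKer_normal_pi).Q j).ι_continuous
    ((qTowerOfSpecialFibreTower X T d S h36 Sigma SigmaHat hsub hne hprime hp TpH HatH hle
      cuspMeetsH P.admKer_normal_pi).Q j).ι_injective hRF K hK hKr

/-- **[IUTchI] Prop. 2.4 (ii) AS TYPED at the genuine 𝔛-datum over `P`, with (A0) at the level quotients supplied from
the residual-finiteness reading (RF)** — `prop24ii_ofPiData_of_arithStatementI_canonical` with `hA0` discharged by
`isCompact_comap_levelQuotient_of_RF`.  Laws: `hadm`; per level `hI` (abc-iut-L3's TYPED [SemiAnbd] Thm 5.4 (i) for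
the canonical augmentation), `hRF` ((RF) at the level quotient), `hA3` ((A3-arith)).  Data: per-level
`DecompositionData`, nodes with tempered branch conjugators.
([IUTchI] Prop 2.4(ii) pp.50-51) [claim: Mochizuki2012, status: disputed] -/
theorem prop24ii_ofPiData_of_arithStatementI_canonical_of_RF (P : SpecialFibreTower.PiData X d S T)
    (hadm : ∀ U ∈ 𝓝 (1 : ↥X.DeltaTemp), ∃ j, ((T.admKer j : Subgroup ↥X.DeltaTemp) : Set ↥X.DeltaTemp) ⊆ U)
    {V B : ℕ → Type*}
    (Dd : ∀ j, DecompositionData ((qTowerOfSpecialFibreTower X T d S h36 Sigma SigmaHat hsub hne hprime hp TpH HatH hle cuspMeetsH P.admKer_normal_pi).Q j).Tp (V j) (B j))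
    (hI : ∀ (j : ℕ) (a : ((qTowerOfSpecialFibreTower X T d S h36 Sigma SigmaHat hsub hne hprime hp TpH HatH hle cuspMeetsH P.admKer_normal_pi).Q j).Tp →* X.GK),
      a.comp ((qTowerOfSpecialFibreTower X T d S h36 Sigma SigmaHat hsub hne hprime hp TpH HatH hle cuspMeetsH P.admKer_normal_pi).qtp j) = X.augGK.toMonoidHom →
        ArithMaximalCompactStatementI (Dd j) a)
    (hRF : ∀ (j : ℕ), ∀ U ∈ 𝓝 (1 : ((qTowerOfSpecialFibreTower X T d S h36 Sigma SigmaHat hsub hne hprime hp TpH HatH hle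
        cuspMeetsH P.admKer_normal_pi).Q j).Tp),
      ∃ N : OpenNormalSubgroup ((qTowerOfSpecialFibreTower X T d S h36 Sigma SigmaHat hsub hne hprime hp TpH HatH hle
          cuspMeetsH P.admKer_normal_pi).Q j).Tp,
        (N : Set _) ⊆ U ∧
          ((N.toSubgroup.map ((qTowerOfSpecialFibreTower X T d S h36 Sigma SigmaHat hsub hne hprime hp TpH HatH hle
              cuspMeetsH P.admKer_normal_pi).Q j).ι).topologicalClosure).comap
            ((qTowerOfSpecialFibreTower X T d S h36 Sigma SigmaHat hsub hne hprime hp TpH HatH hle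
              cuspMeetsH P.admKer_normal_pi).Q j).ι ≤ N.toSubgroup)
    {E : ℕ → Type*} (src tgt : ∀ j, E j → V j)
    (c₁ c₂ : ∀ j, E j → ((qTowerOfSpecialFibreTower X T d S h36 Sigma SigmaHat hsub hne hprime hp TpH HatH hle cuspMeetsH P.admKer_normal_pi).Q j).Tp)
    (hA3 : ∀ (j : ℕ) (Λ : Subgroup X.PiTemp), IsCompact (Λ : Set X.PiTemp) → Λ ≠ ⊥ →
      IsOpen (Λ.map X.augGK.toMonoidHom : Set X.GK) →
      ∀ (v w : V j) (g h γ : ((qTowerOfSpecialFibreTower X T d S h36 Sigma SigmaHat hsub hne hprime hp TpH HatH hle cuspMeetsH P.admKer_normal_pi).Q j).Hat),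
        MulAut.conj γ • Λ.map (((qTowerOfSpecialFibreTower X T d S h36 Sigma SigmaHat hsub hne hprime hp TpH HatH hle cuspMeetsH P.admKer_normal_pi).qhat j).comp X.toHat.toMonoidHom) ≤
            MulAut.conj g • ((Dd j).vertGp v).map ((qTowerOfSpecialFibreTower X T d S h36 Sigma SigmaHat hsub hne hprime hp TpH HatH hle cuspMeetsH P.admKer_normal_pi).Q j).ι →
        MulAut.conj γ • Λ.map (((qTowerOfSpecialFibreTower X T d S h36 Sigma SigmaHat hsub hne hprime hp TpH HatH hle cuspMeetsH P.admKer_normal_pi).qhat j).comp X.toHat.toMonoidHom) ≤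
            MulAut.conj h • ((Dd j).vertGp w).map ((qTowerOfSpecialFibreTower X T d S h36 Sigma SigmaHat hsub hne hprime hp TpH HatH hle cuspMeetsH P.admKer_normal_pi).Q j).ι →
          (v = w ∧ g⁻¹ * h ∈ ((Dd j).vertGp v).map ((qTowerOfSpecialFibreTower X T d S h36 Sigma SigmaHat hsub hne hprime hp TpH HatH hle cuspMeetsH P.admKer_normal_pi).Q j).ι) ∨
          (∃ (e : E j) (k : ((qTowerOfSpecialFibreTower X T d S h36 Sigma SigmaHat hsub hne hprime hp TpH HatH hle cuspMeetsH P.admKer_normal_pi).Q j).Hat),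
            ∃ p ∈ ((Dd j).vertGp (src j e)).map ((qTowerOfSpecialFibreTower X T d S h36 Sigma SigmaHat hsub hne hprime hp TpH HatH hle cuspMeetsH P.admKer_normal_pi).Q j).ι,
            ∃ q ∈ ((Dd j).vertGp (tgt j e)).map ((qTowerOfSpecialFibreTower X T d S h36 Sigma SigmaHat hsub hne hprime hp TpH HatH hle cuspMeetsH P.admKer_normal_pi).Q j).ι,
            (src j e = v ∧ tgt j e = w ∧
                g = k * ((qTowerOfSpecialFibreTower X T d S h36 Sigma SigmaHat hsub hne hprime hp TpH HatH hle cuspMeetsH P.admKer_normal_pi).Q j).ι (c₁ j e) * p ∧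
                h = k * ((qTowerOfSpecialFibreTower X T d S h36 Sigma SigmaHat hsub hne hprime hp TpH HatH hle cuspMeetsH P.admKer_normal_pi).Q j).ι (c₂ j e) * q) ∨
            (src j e = w ∧ tgt j e = v ∧
                h = k * ((qTowerOfSpecialFibreTower X T d S h36 Sigma SigmaHat hsub hne hprime hp TpH HatH hle cuspMeetsH P.admKer_normal_pi).Q j).ι (c₁ j e) * p ∧
                g = k * ((qTowerOfSpecialFibreTower X T d S h36 Sigma SigmaHat hsub hne hprime hp TpH HatH hle cuspMeetsH P.admKer_normal_pi).Q j).ι (c₂ j e) * q)) ∨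
          (∃ (u : V j) (f : ((qTowerOfSpecialFibreTower X T d S h36 Sigma SigmaHat hsub hne hprime hp TpH HatH hle cuspMeetsH P.admKer_normal_pi).Q j).Hat),
            (∃ (e : E j) (k : ((qTowerOfSpecialFibreTower X T d S h36 Sigma SigmaHat hsub hne hprime hp TpH HatH hle cuspMeetsH P.admKer_normal_pi).Q j).Hat),
              ∃ p ∈ ((Dd j).vertGp (src j e)).map ((qTowerOfSpecialFibreTower X T d S h36 Sigma SigmaHat hsub hne hprime hp TpH HatH hle cuspMeetsH P.admKer_normal_pi).Q j).ι,
              ∃ q ∈ ((Dd j).vertGp (tgt j e)).map ((qTowerOfSpecialFibreTower X T d S h36 Sigma SigmaHat hsub hne hprime hp TpH HatH hle cuspMeetsH P.admKer_normal_pi).Q j).ι,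
              (src j e = v ∧ tgt j e = u ∧
                  g = k * ((qTowerOfSpecialFibreTower X T d S h36 Sigma SigmaHat hsub hne hprime hp TpH HatH hle cuspMeetsH P.admKer_normal_pi).Q j).ι (c₁ j e) * p ∧
                  f = k * ((qTowerOfSpecialFibreTower X T d S h36 Sigma SigmaHat hsub hne hprime hp TpH HatH hle cuspMeetsH P.admKer_normal_pi).Q j).ι (c₂ j e) * q) ∨
              (src j e = u ∧ tgt j e = v ∧
                  f = k * ((qTowerOfSpecialFibreTower X T d S h36 Sigma SigmaHat hsub hne hprime hp TpH HatH hle cuspMeetsH P.admKer_normal_pi).Q j).ι (c₁ j e) * p ∧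
                  g = k * ((qTowerOfSpecialFibreTower X T d S h36 Sigma SigmaHat hsub hne hprime hp TpH HatH hle cuspMeetsH P.admKer_normal_pi).Q j).ι (c₂ j e) * q)) ∧
            (∃ (e : E j) (k : ((qTowerOfSpecialFibreTower X T d S h36 Sigma SigmaHat hsub hne hprime hp TpH HatH hle cuspMeetsH P.admKer_normal_pi).Q j).Hat),
              ∃ p ∈ ((Dd j).vertGp (src j e)).map ((qTowerOfSpecialFibreTower X T d S h36 Sigma SigmaHat hsub hne hprime hp TpH HatH hle cuspMeetsH P.admKer_normal_pi).Q j).ι,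
              ∃ q ∈ ((Dd j).vertGp (tgt j e)).map ((qTowerOfSpecialFibreTower X T d S h36 Sigma SigmaHat hsub hne hprime hp TpH HatH hle cuspMeetsH P.admKer_normal_pi).Q j).ι,
              (src j e = u ∧ tgt j e = w ∧
                  f = k * ((qTowerOfSpecialFibreTower X T d S h36 Sigma SigmaHat hsub hne hprime hp TpH HatH hle cuspMeetsH P.admKer_normal_pi).Q j).ι (c₁ j e) * p ∧
                  h = k * ((qTowerOfSpecialFibreTower X T d S h36 Sigma SigmaHat hsub hne hprime hp TpH HatH hle cuspMeetsH P.admKer_normal_pi).Q j).ι (c₂ j e) * q) ∨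
              (src j e = w ∧ tgt j e = u ∧
                  h = k * ((qTowerOfSpecialFibreTower X T d S h36 Sigma SigmaHat hsub hne hprime hp TpH HatH hle cuspMeetsH P.admKer_normal_pi).Q j).ι (c₁ j e) * p ∧
                  f = k * ((qTowerOfSpecialFibreTower X T d S h36 Sigma SigmaHat hsub hne hprime hp TpH HatH hle cuspMeetsH P.admKer_normal_pi).Q j).ι (c₂ j e) * q)))) :
    (ofSpecialFibre X d S h36 Sigma SigmaHat hsub hne hprime hp TpH HatH hle cuspMeetsH).Prop24ii := by
  refine prop24ii_ofPiData_of_arithStatementI_canonical X T d S h36 Sigma SigmaHat hsub hne hprime hp TpH HatH hle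
    cuspMeetsH P hadm Dd hI ?_ src tgt c₁ c₂ hA3
  -- (A0)_j from (RF)_j: the conjugate `γ • M` is compact (image of the compact `Λ`) and lies in `ι(Π^tp_j)`
  intro j Λ hΛc _ _ γ hγ
  haveI : (admKerHat X T j).Normal := admKerHat_normal X T j (P.admKer_normal_pi j)
  let HatJ : Type := ((qTowerOfSpecialFibreTower X T d S h36 Sigma SigmaHat hsub hne hprime hp TpH HatH hle
    cuspMeetsH P.admKer_normal_pi).Q j).Hat
  refine isCompact_comap_levelQuotient_of_RF X T d S h36 Sigma SigmaHat hsub hne hprime hp TpH HatH hle cuspMeetsH P j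
    (hRF j) _ ?_ hγ
  -- compactness of `γ • M`
  have hq : Continuous ((qTowerOfSpecialFibreTower X T d S h36 Sigma SigmaHat hsub hne hprime hp TpH HatH hle
      cuspMeetsH P.admKer_normal_pi).qhat j) := by
    change Continuous (QuotientGroup.mk' (admKerHat X T j))
    exact QuotientGroup.continuous_mk
  have hM : IsCompact ((Λ.map (((qTowerOfSpecialFibreTower X T d S h36 Sigma SigmaHat hsub hne hprime hp TpH HatH hle
      cuspMeetsH P.admKer_normal_pi).qhat j).comp X.toHat.toMonoidHom) : Subgroup HatJ) : Set HatJ) := by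
    rw [Subgroup.coe_map]
    exact hΛc.image (hq.comp X.toHat.continuous)
  have e : ((MulAut.conj γ • Λ.map (((qTowerOfSpecialFibreTower X T d S h36 Sigma SigmaHat hsub hne hprime hp TpH
      HatH hle cuspMeetsH P.admKer_normal_pi).qhat j).comp X.toHat.toMonoidHom) : Subgroup HatJ) : Set HatJ) =
      (fun y => γ * y * γ⁻¹) '' ((Λ.map (((qTowerOfSpecialFibreTower X T d S h36 Sigma SigmaHat hsub hne hprime hp TpH
        HatH hle cuspMeetsH P.admKer_normal_pi).qhat j).comp X.toHat.toMonoidHom) : Subgroup HatJ) : Set HatJ) := by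
    ext y
    simp only [SetLike.mem_coe, Subgroup.mem_smul_pointwise_iff_exists, Set.mem_image, MulAut.smul_def,
      MulAut.conj_apply]
    constructor
    · rintro ⟨m, hm, rfl⟩
      exact ⟨m, hm, rfl⟩
    · rintro ⟨m, hm, rfl⟩
      exact ⟨m, hm, rfl⟩
  rw [e]
  exact hM.image ((continuous_const.mul continuous_id).mul continuous_const)

end OfSpecialFibre

end StableCurveTemperedData

end Literature.IUT.HodgeTheaters

end
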